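import Summits.RiemannHypothesis.RiemannHypothesis.Theses.DBN
import Summits.RiemannHypothesis.RiemannHypothesis.Theorems.DBNKernelMasses
import HarnessLib

/-!
# RiemannHypothesis / DBN — closers for the route's RH-FREE support items proved in `DBNKernelMasses` / `DBNZeroDynamics`

Route `RiemannHypothesis/DBN` (reactivated 2026-08-25 under D-0059) carries nine support items whose
statements are, BY NAME, the typed RH-FREE Props of `Theorems/DBNDefs.lean` / `DBNZeroDynamics.lean`
(column DBN of the RH ladder, RUNG N-P (P3)).  This file states five of them AS THE ROUTE DECLS and proves
each in one line from the landed `_holds` theorem (the sixth open one, `DbnClassFloorExitTime` 18763, is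
closed by `DBNRouteClosers.lean`, which also needs `DBNClassFloor.lean`):

* `dbnNetWeightCeiling_closed`      : `DBN.DbnNetWeightCeiling`      (stmt-RiemannHypothesis-18761, T1c)
* `dbnDoubleRowInvisibility_closed` : `DBN.DbnDoubleRowInvisibility` (18762, N1)
* `dbnSumSqHeightsLyapunov_closed`  : `DBN.DbnSumSqHeightsLyapunov`  (18764, T7)
* `dbnUpperHeightSumDescent_closed` : `DBN.DbnUpperHeightSumDescent` (18765, T8)
* `dbnRoofDeficitProfile_closed`    : `DBN.DbnRoofDeficitProfile`    (18766, T9)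

All RH-FREE; none bears on the cruxes `DbnHighUniform` / `DbnLowAllT` (RH-EQUIVALENT) or on the truth of RH.
-/

-- D-0017: `Summit.<S>.<S>.…` is the designed namespace of a single-problem summit.
set_option linter.dupNamespace false

namespace Summit.RiemannHypothesis.RiemannHypothesis.Theorems

open Summit.RiemannHypothesis.RiemannHypothesis.Theses

/-- Item stmt-RiemannHypothesis-18761 (T1c net-weight ceiling), from `DbnTheory.NetWeightCeiling_holds`. [folklore] -/
theorem dbnNetWeightCeiling_closed : DBN.DbnNetWeightCeiling :=
  DbnTheory.NetWeightCeiling_holds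

/-- Item stmt-RiemannHypothesis-18762 (N1 double-row invisibility), from `DbnTheory.DoubleRowInvisibility_holds`. [folklore] -/
theorem dbnDoubleRowInvisibility_closed : DBN.DbnDoubleRowInvisibility :=
  DbnTheory.DoubleRowInvisibility_holds

/-- Item stmt-RiemannHypothesis-18764 (T7 `Σ y²` Lyapunov identity), from `DbnTheory.SumSqHeightsLyapunov_holds`. [folklore] -/
theorem dbnSumSqHeightsLyapunov_closed : DBN.DbnSumSqHeightsLyapunov :=
  DbnTheory.SumSqHeightsLyapunov_holds

/-- Item stmt-RiemannHypothesis-18765 (T8 upper-height descent), from `DbnTheory.UpperHeightSumDescent_holds`. [folklore] -/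
theorem dbnUpperHeightSumDescent_closed : DBN.DbnUpperHeightSumDescent :=
  DbnTheory.UpperHeightSumDescent_holds

/-- Item stmt-RiemannHypothesis-18766 (T9 roof-deficit masses), from `DbnTheory.RoofDeficitProfile_holds`. [folklore] -/
theorem dbnRoofDeficitProfile_closed : DBN.DbnRoofDeficitProfile :=
  DbnTheory.RoofDeficitProfile_holds

end Summit.RiemannHypothesis.RiemannHypothesis.Theorems
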